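import Summits.ResolutionOfSingularities.ResolutionOfSingularities.Theorems.EquisingularLiftEquisingularLiftNatSubchainPointResolutionOff
import Summits.ResolutionOfSingularities.ResolutionOfSingularities.Theorems.EquisingularLiftEquisingularLiftNatNDInvPersists
import Summits.ResolutionOfSingularities.ResolutionOfSingularities.Theorems.EquisingularLiftEquisingularLiftNatNDSNCInv2
import Summits.ResolutionOfSingularities.ResolutionOfSingularities.Theorems.EquisingularLiftEquisingularLiftNatNDRoundModel
import Summits.ResolutionOfSingularities.ResolutionOfSingularities.Theorems.EquisingularLiftEquisingularLiftNatResidueHypDefsND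
import Summits.ResolutionOfSingularities.ResolutionOfSingularities.Theorems.EquisingularLiftEquisingularLiftNatResidueHypDefs
import Summits.ResolutionOfSingularities.ResolutionOfSingularities.Theorems.EquisingularLiftEquisingularLiftNatNDRoundModelSplit
import Summits.ResolutionOfSingularities.ResolutionOfSingularities.Theorems.EquisingularLiftEquisingularLiftNatSNCInvStepFacts
import Summits.ResolutionOfSingularities.ResolutionOfSingularities.Theorems.EquisingularLiftEquisingularLiftNatNDStratumFacts
import Summits.ResolutionOfSingularities.ResolutionOfSingularities.Theorems.EquisingularLiftEquisingularLiftNatNDSncInvInit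
import Summits.ResolutionOfSingularities.ResolutionOfSingularities.Theorems.EquisingularLiftEquisingularLiftNatNDTransportInit
import Summits.ResolutionOfSingularities.ResolutionOfSingularities.Theorems.EquisingularLiftEquisingularLiftNatNDTransportStep
import Summits.ResolutionOfSingularities.ResolutionOfSingularities.Theorems.EquisingularLiftEquisingularLiftNatNDPlayFacts
import Summits.ResolutionOfSingularities.ResolutionOfSingularities.Theorems.EquisingularLiftEquisingularLiftNatNDModelRoundEnd
import Summits.ResolutionOfSingularities.ResolutionOfSingularities.Theorems.EquisingularLiftEquisingularLiftNatNDModelInit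
import Summits.ResolutionOfSingularities.ResolutionOfSingularities.Theorems.EquisingularLiftEquisingularLiftNatNDInvInit
import Summits.ResolutionOfSingularities.ResolutionOfSingularities.Theorems.EquisingularLiftEquisingularLiftNatNDModelStep
import Summits.ResolutionOfSingularities.ResolutionOfSingularities.Theorems.EquisingularLiftEquisingularLiftNatNDTransportEnd
import HarnessLib

/-!
# EL♮(3) ND rung — CLOSING FILE: the registered 4th CHILD stub `stub_elnat_three_isolated_newtonNondegenerate` BY NAME (desk R31 (β) DEAL «ND-K5»)

FINAL — all eleven bricks are TREE THEOREMS and are imported; this file is sorry-free and hypothesis-free (no `variable` brick).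

Text owner res-L1-w45b-lead-2 g7 (L1 W4.5b).  The derived theorems are res-L1-w45b-idea-1's SPEC v12
`Cruxes/EquisingularLiftNatThree/NewtonNondegenerateRungK5.lean` 99465c56d0b22ab5: §13.7 `hsub_strataLift`, §13.14/13.15 `modelRound` / `transportRoundLN` /
`roundAtNDFrameLN` / `ndInvLN_round`, §13.11 `hres_toricRounds`, §13.8 `nd_rung_local_K5` — bodies VERBATIM (generator `make_closure.py` 9077b311e4bdb8c2, `--mode final`) —
over the TREE bricks (B3a) `ND.sncInv_init` (res-type-027, p642183) · (B3g) `ND.sncInv_stratumFacts` (res-L1-w45b-stub-4, p641592) · (B3b) `ND.sncInv_stepFacts`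
(res-L1-w45b-stub-2, p641843) · (B4γ) `ND.ndInv_init` (res-L1-w45b-nose-w1 with res-type-027, p645490) · (B4α0) `ND.playFacts` (res-L1-w45b-iso-w3, p644429) ·
(B4α1i) `ND.modelInit` (res-L1-w45b-stub-4, p644838) · (B4α1s) `ND.modelStep` (res-L1-w45b-stub-4 with res-L1-w45b-iso-w1, p646530) · (B4α2) `ND.modelEnd`
(res-L1-w45b-iso-w1, p644394) · (B4β0) `ND.transportInit` (res-L1-w45b-stub-2, p644379) · (B4β1) `ND.transportStep` (res-L1-w45b-nose-w2, p644680) ·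
(B4β2) `ND.transportEnd` (res-L1-w45b-iso-w2, p646559) · (B4β′) `ND.ndInvPersists` (res-L1-w45b-lead-2, p640760), the tree compositions
`ND.hsub_strataLift_of_invariant` / `ND.ndInvLN_round_of` / `ND.ndInvCLN_end` / `ND.hres_of_rounds` / `ND.modelRound_of_toricStage` / `ND.transportRoundLN_of_toricStage` /
`ND.roundAtNDFrameLN_of_model` (ports p638808, p639684, p641231, p643982 by res-L1-w45b-lead-2) and K5′ `target_elnat_of_subchainResolution'`
(`…NatSubchainPointResolutionOff`).  The last theorem has the REGISTERED name and signature (TARGET 7fcd0bcbb3baba29, namespace `…Sections`) and is what the texts of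
record import at the 35th (count-reducing) registration.  [OURS · L1 W4.5b · pure logic over the bricks · counted 0 · AI kernel work, weaker than expert review;
nothing of [Hironaka2017] is asserted; EL♮(3) itself is NOT proved by this file — it closes ONE of the four registered CHILD stubs]
-/

set_option linter.overlappingInstances false
set_option linter.dupNamespace false -- mandated namespace `Summit.<Summit>.<Problem>` of this single-conjunct summit

open CategoryTheory CategoryTheory.Limits AlgebraicGeometry TopologicalSpace Topology
open MvPolynomial
open Literature.AlgebraicGeometry.Resolution
open AlgebraicGeometry.Scheme.IdealSheafData

namespace Summit.ResolutionOfSingularities.ResolutionOfSingularities.Cruxes.EquisingularLiftNat.Sections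

namespace ND

/-- **(B3) `hsub_strataLift` DERIVED** from the candidate invariant's three clauses (B3a) `sncInv_init`, (B3g) `sncInv_stratumFacts`, (B3b) `sncInv_stepFacts`
through the PROVED iteration `hsub_strataLift_of_invariant` (all three clauses are tree theorems: p642183, p641592, p641843).  [OURS · L1 W4.5b · pure logic] -/
theorem hsub_strataLift (k : Type) [Field k] (n : ℕ) :
    (∀ (O : Type) [CommRing O] [IsDomain O] [IsDiscreteValuationRing O] [IsAdicComplete (IsLocalRing.maximalIdeal O) O]
        [IsAlgClosed (IsLocalRing.ResidueField O)] (θ : O →+* k), Function.Surjective θ →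
      ∀ (P : AlgebraicGeometry.Scheme.{0}) (q : P ⟶ AlgebraicGeometry.Spec (.of O)) (Y : Set P)
        (Ch : ∀ X' : AlgebraicGeometry.Scheme.{0}, (X' ⟶ P) → Set X' → Prop),
        (∀ (X' X'' : AlgebraicGeometry.Scheme.{0}) (σ' : X' ⟶ P) (S' : Set X') (C : X'.IdealSheafData) (τ : X'' ⟶ X'),
          Ch X' σ' S' → Literature.AlgebraicGeometry.Resolution.IsBlowup τ C →
          Literature.AlgebraicGeometry.Resolution.Scheme.IsRegular C.subscheme → AlgebraicGeometry.Flat (C.subschemeι ≫ σ' ≫ q) →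
          σ' '' (C.support : Set X') ⊆ {y | ¬ IsGenericPoint y Y} →
          (C.support : Set X') ∩ (σ' ≫ q) ⁻¹' {IsLocalRing.closedPoint O} ⊆ S' →
          Ch X'' (τ ≫ σ') (closure (τ ⁻¹' (S' \ (C.support : Set X'))))) →
        (∀ (X' : AlgebraicGeometry.Scheme.{0}) (σ' : X' ⟶ P) (S' : Set X'), Ch X' σ' S' →
          Summit.ResolutionOfSingularities.ResolutionOfSingularities.Theses.EquisingularLift.Split.Chain P Y X' σ' S') →
        Y ⊆ q ⁻¹' {IsLocalRing.closedPoint O} → IsIrreducible Y → IsClosed Y →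
        AlgebraicGeometry.IsIntegral P → IsLocallyNoetherian P → Literature.AlgebraicGeometry.Resolution.Scheme.IsRegular P →
        AlgebraicGeometry.IsProper q → AlgebraicGeometry.SmoothOfRelativeDimension n q →
      -- the stage before the point step and its model
      ∀ (X' : AlgebraicGeometry.Scheme.{0}) (σ' : X' ⟶ P) (S' : Set X'), Ch X' σ' S' → AlgebraicGeometry.IsIntegral X' →
        IsLocallyNoetherian X' → Literature.AlgebraicGeometry.Resolution.Scheme.IsRegular X' →
        AlgebraicGeometry.IsDominant (σ' ≫ q) →
      ∀ (F₁ : AlgebraicGeometry.Scheme.{0}), AlgebraicGeometry.IsIntegral F₁ → ∀ (j : F₁ ⟶ X')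
        (t : F₁ ⟶ AlgebraicGeometry.Spec (.of k)),
        IsPullback j t (σ' ≫ q) (AlgebraicGeometry.Spec.map (CommRingCat.ofHom θ)) →
      ∀ (T₁ : Set F₁), IsClosed T₁ → IsIrreducible T₁ → j '' T₁ = S' →
      -- the point step: section, its blow-up, the new stage and its model
      ∀ (x : F₁) (hx : IsClosed ({x} : Set F₁)) (U : X'.Opens), AlgebraicGeometry.Smooth (U.ι ≫ σ' ≫ q) →
      ∀ (s : AlgebraicGeometry.Spec (.of O) ⟶ X'), s ≫ σ' ≫ q = 𝟙 _ → s (IsLocalRing.closedPoint O) ∈ U →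
        s (IsLocalRing.closedPoint O) = j x →
        ringKrullDim (X'.presheaf.stalk (s (IsLocalRing.closedPoint O))) = ((n + 1 : ℕ) : WithBot ℕ∞) →
        IsRegularLocalRing (F₁.presheaf.stalk x) →
        (∀ c ∈ (s.ker.support : Set X'), ¬ IsGenericPoint (σ' c) Y) →
      ∀ (X₁ : AlgebraicGeometry.Scheme.{0}) (τ₁ : X₁ ⟶ X'), Literature.AlgebraicGeometry.Resolution.IsBlowup τ₁ s.ker →
        AlgebraicGeometry.IsIntegral X₁ → IsLocallyNoetherian X₁ → Literature.AlgebraicGeometry.Resolution.Scheme.IsRegular X₁ →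
        AlgebraicGeometry.IsDominant ((τ₁ ≫ σ') ≫ q) →
      ∀ (F₂ : AlgebraicGeometry.Scheme.{0}), AlgebraicGeometry.IsIntegral F₂ → ∀ (υ : F₂ ⟶ F₁),
        Literature.AlgebraicGeometry.Resolution.IsBlowup υ
          (AlgebraicGeometry.Scheme.IdealSheafData.vanishingIdeal (⟨{x}, hx⟩ : TopologicalSpace.Closeds F₁)) →
      ∀ (j₂ : F₂ ⟶ X₁) (t₂ : F₂ ⟶ AlgebraicGeometry.Spec (.of k)),
        IsPullback j₂ t₂ ((τ₁ ≫ σ') ≫ q) (AlgebraicGeometry.Spec.map (CommRingCat.ofHom θ)) → j₂ ≫ τ₁ = υ ≫ j →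
        (s.ker.comap τ₁).comap j₂ =
          (AlgebraicGeometry.Scheme.IdealSheafData.vanishingIdeal (⟨{x}, hx⟩ : TopologicalSpace.Closeds F₁)).comap υ →
        IsIrreducible (closure (υ ⁻¹' (T₁ \ {x}))) →
        Ch X₁ (τ₁ ≫ σ') (j₂ '' closure (υ ⁻¹' (T₁ \ {x}))) →
      -- the admissible downstairs sub-chains are matched upstairs
      ∀ (F₉ : AlgebraicGeometry.Scheme.{0}) (β : F₉ ⟶ F₂) (T₉ : Set F₉), ReachToric n F₁ F₂ υ x (closure (υ ⁻¹' (T₁ \ {x}))) F₉ β T₉ →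
        ∃ (X₉ : AlgebraicGeometry.Scheme.{0}) (σ₉ : X₉ ⟶ P) (S₉ : Set X₉) (j₉ : F₉ ⟶ X₉)
          (t₉ : F₉ ⟶ AlgebraicGeometry.Spec (.of k)),
          Ch X₉ σ₉ S₉ ∧ AlgebraicGeometry.IsIntegral X₉ ∧ IsLocallyNoetherian X₉ ∧
          Literature.AlgebraicGeometry.Resolution.Scheme.IsRegular X₉ ∧ AlgebraicGeometry.IsDominant (σ₉ ≫ q) ∧
          IsPullback j₉ t₉ (σ₉ ≫ q) (AlgebraicGeometry.Spec.map (CommRingCat.ofHom θ)) ∧ j₉ '' T₉ = S₉ ∧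
          IsClosed T₉ ∧ IsIrreducible T₉ ∧ AlgebraicGeometry.IsIntegral F₉) := by
  refine hsub_strataLift_of_invariant k n ?_
  intro O _ _ _ _ _ θ hθ P q Y Ch hStep hChain hYq hYirr hYcl hPint hPn hPreg hqpr hqsm X' σ' S' hCh hX'i hX'n hX'r hdom F₁ hF₁ j t hsq
    T₁ hT₁cl hT₁irr hjT x hx U hU s hs hsU hsx hdim hregx hoffs X₁ τ₁ hτ₁ hX₁i hX₁n hX₁r hX₁dom F₂ hF₂ υ hυ j₂ t₂ hsq₂ hcomm hcarr
    hT₂irr hCh₁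
  exact ⟨SNCInv₂ (n := n) P Y,
    sncInv_init k n O θ hθ P q Y Ch hStep hChain hYq hYirr hYcl hPint hPn hPreg hqpr hqsm X' σ' S' hCh hX'i hX'n hX'r hdom F₁ hF₁ j t hsq
      T₁ hT₁cl hT₁irr hjT x hx U hU s hs hsU hsx hdim hregx hoffs X₁ τ₁ hτ₁ hX₁i hX₁n hX₁r hX₁dom F₂ hF₂ υ hυ j₂ t₂ hsq₂ hcomm hcarr
      hT₂irr hCh₁,
    sncInv_stratumFacts O k θ hθ P q Y Ch n, sncInv_stepFacts O k θ hθ P q Y Ch n⟩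

section RoundSplit

variable (n : ℕ) (k : Type) [Field k]

/-- **(B4α) DERIVED** (v9; was a `sorry` in v8/v8.1): from (B4α0) `playFacts`, (B4α1i) `modelInit`, (B4α1s) `modelStep`, (B4α2) `modelEnd` by
`modelRound_of_toricStage`.  `[IsAlgClosed k]` (crit-3 OBJECTION 2026-08-28T14:21:05Z SUSTAINED 14:21:14Z — witness `n = 2, k = ℚ, g = (X₀²+2X₁²)² + X₀⁶ + X₁⁶`:
the tree's `IsLocallyNewtonNondegenerate` is over k-RATIONAL torus points).  Prover hint for the model: after `obtain ⟨m, rfl⟩ : ∃ m, n = m + 1`,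
`Aff (m+1) k = AffinePointBlowup.P m k` and `affOrigin (m+1) k = AffinePointBlowup.ξ m k` hold by `rfl`.  [OURS · L1 W4.5b] -/
theorem modelRound [IsAlgClosed k] (g : MvPolynomial (Fin n) k) (hg : LocalNDWon g) : ModelRound n k g :=
  modelRound_of_toricStage n k (playFacts n) (modelInit n k) (modelStep n k) (modelEnd n k) g hg

/-- **(B4β-LN) DERIVED** (v11): the LN transport round from the model bricks (B4α0)/(B4α1i)/(B4α1s)/(B4α2) and the transport bricks (B4β0)/(B4β1)/(B4β2) by
`transportRoundLN_of_toricStage`.  [OURS · L1 W4.5b] -/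
theorem transportRoundLN [IsAlgClosed k] : TransportRoundLN n k :=
  transportRoundLN_of_toricStage n k (playFacts n) (modelInit n k) (modelStep n k) (modelEnd n k) (transportInit n k) (transportStep n k) (transportEnd n k)

/-- **(B4α′-LN) DERIVED** from (B4α) `modelRound` and (B4β-LN) `transportRoundLN`. [OURS · L1 W4.5b] -/
theorem roundAtNDFrameLN [IsAlgClosed k] : RoundAtNDFrameLN n k :=
  roundAtNDFrameLN_of_model n k (modelRound n k) (transportRoundLN n k)

/-- **(B4-round-LN) DERIVED** (for the closed LN variant `NDInvCLN`). [OURS · L1 W4.5b] -/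
theorem ndInvLN_round [IsAlgClosed k] : RoundFacts n k (NDInvCLN n k) :=
  ndInvLN_round_of n k (roundAtNDFrameLN n k) (ndInvPersists n k)

end RoundSplit

/-- **(B4) `hres_toricRounds` — K5′'s `hres` BLOCK at `Reach := ReachToric n`, under `nd_rung_local`'s hypotheses; DERIVED (v4) from (B4-init) `ndInv_init`,
(B4-end) `ndInvCLN_end` (proved), (B4-round-LN) `ndInvLN_round` through the PROVED k-side iteration `hres_of_rounds`.**  [OURS · L1 W4.5b] -/
theorem hres_toricRounds (n : ℕ) (p : ℕ) (hp : p.Prime) (k : Type) [Field k] [CharP k p] [IsAlgClosed k]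
    (H : AlgebraicGeometry.Scheme.{0}) (ι : H ⟶ (Literature.AlgebraicGeometry.Motives.projectiveSpace n k).left)
    (hι : AlgebraicGeometry.IsClosedImmersion ι) (hH : AlgebraicGeometry.IsIntegral H)
    (hloc : ∀ y : (Literature.AlgebraicGeometry.Motives.projectiveSpace n k).left,
      ∃ U : (Literature.AlgebraicGeometry.Motives.projectiveSpace n k).left.affineOpens,
        y ∈ (U : (Literature.AlgebraicGeometry.Motives.projectiveSpace n k).left.Opens) ∧ (ι.ker.ideal U).IsPrincipal)
    (hfin : Set.Finite {x : H | ¬ IsRegularLocalRing (H.presheaf.stalk x)})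
    (hND : IsoHypNDWon k n H ι) :
    (∃ (F' : AlgebraicGeometry.Scheme.{0}) (ρ' : F' ⟶ (Literature.AlgebraicGeometry.Motives.projectiveSpace n k).left)
        (T' : Set F'),
      (∀ Q : (∀ F₁ : AlgebraicGeometry.Scheme.{0}, (F₁ ⟶ (Literature.AlgebraicGeometry.Motives.projectiveSpace n k).left) →
          Set F₁ → Prop),
        Q (Literature.AlgebraicGeometry.Motives.projectiveSpace n k).left
          (𝟙 (Literature.AlgebraicGeometry.Motives.projectiveSpace n k).left) (Set.range ι) →
        (∀ (F₁ F₂ : AlgebraicGeometry.Scheme.{0}) (ρ : F₁ ⟶ (Literature.AlgebraicGeometry.Motives.projectiveSpace n k).left)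
            (T₁ : Set F₁)
            (x : ↥(AlgebraicGeometry.Scheme.IdealSheafData.vanishingIdeal
              (⟨closure T₁, isClosed_closure⟩ : TopologicalSpace.Closeds F₁)).subscheme)
            (υ : F₂ ⟶ F₁)
            (hx : IsClosed ({((AlgebraicGeometry.Scheme.IdealSheafData.vanishingIdeal
              (⟨closure T₁, isClosed_closure⟩ : TopologicalSpace.Closeds F₁)).subschemeι x : F₁)} : Set F₁)),
          Q F₁ ρ T₁ →
          ¬ IsRegularLocalRing ((AlgebraicGeometry.Scheme.IdealSheafData.vanishingIdeal
              (⟨closure T₁, isClosed_closure⟩ : TopologicalSpace.Closeds F₁)).subscheme.presheaf.stalk x) →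
          IsRegularLocalRing (F₁.presheaf.stalk ((AlgebraicGeometry.Scheme.IdealSheafData.vanishingIdeal
              (⟨closure T₁, isClosed_closure⟩ : TopologicalSpace.Closeds F₁)).subschemeι x)) →
          Literature.AlgebraicGeometry.Resolution.IsBlowup υ
            (AlgebraicGeometry.Scheme.IdealSheafData.vanishingIdeal
              (⟨{((AlgebraicGeometry.Scheme.IdealSheafData.vanishingIdeal
                (⟨closure T₁, isClosed_closure⟩ : TopologicalSpace.Closeds F₁)).subschemeι x : F₁)}, hx⟩ :
                TopologicalSpace.Closeds F₁)) →
          Q F₂ (υ ≫ ρ) (closure (υ ⁻¹' (T₁ \ {((AlgebraicGeometry.Scheme.IdealSheafData.vanishingIdeal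
              (⟨closure T₁, isClosed_closure⟩ : TopologicalSpace.Closeds F₁)).subschemeι x : F₁)}))) ∧
          (∀ (F₉ : AlgebraicGeometry.Scheme.{0}) (β : F₉ ⟶ F₂) (T₉ : Set F₉),
            ReachToric n F₁ F₂ υ ((AlgebraicGeometry.Scheme.IdealSheafData.vanishingIdeal
                (⟨closure T₁, isClosed_closure⟩ : TopologicalSpace.Closeds F₁)).subschemeι x)
              (closure (υ ⁻¹' (T₁ \ {((AlgebraicGeometry.Scheme.IdealSheafData.vanishingIdeal
                (⟨closure T₁, isClosed_closure⟩ : TopologicalSpace.Closeds F₁)).subschemeι x : F₁)}))) F₉ β T₉ →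
            Q F₉ ((β ≫ υ) ≫ ρ) T₉)) →
        Q F' ρ' T') ∧
      Literature.AlgebraicGeometry.Resolution.Scheme.IsRegular (AlgebraicGeometry.Scheme.IdealSheafData.vanishingIdeal
        (⟨closure T', isClosed_closure⟩ : TopologicalSpace.Closeds F')).subscheme) :=
  by
    obtain ⟨m, hm⟩ := ndInv_init n p hp k H ι hι hH hloc hfin hND
    haveI := hι
    have hLNP : IsLocallyNoetherian (Literature.AlgebraicGeometry.Motives.projectiveSpace n k).left :=
      AlgebraicGeometry.LocallyOfFiniteType.isLocallyNoetherian (Literature.AlgebraicGeometry.Motives.projectiveSpace n k).hom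
    exact hres_of_rounds n k H ι (NDInvCLN n k) ⟨m, ⟨hm, ι.isClosedEmbedding.isClosed_range⟩, hLNP⟩ (ndInvCLN_end n k) (ndInvLN_round n k)

/-- **`nd_rung_local_K5`** — the type of NNR §10.3 `nd_rung_local` VERBATIM (every `n`), PROVED from (B3) `hsub_strataLift` and (B4) `hres_toricRounds` by the
tree's K5′ `target_elnat_of_subchainResolution'` at `Reach := ReachToric n`.  [OURS · L1 W4.5b · pure logic over K5′] -/
theorem nd_rung_local_K5 (n : ℕ) (p : ℕ) (hp : p.Prime) (k : Type) [Field k] [CharP k p] [IsAlgClosed k]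
    (H : AlgebraicGeometry.Scheme.{0}) (ι : H ⟶ (Literature.AlgebraicGeometry.Motives.projectiveSpace n k).left)
    (hι : AlgebraicGeometry.IsClosedImmersion ι) (hH : AlgebraicGeometry.IsIntegral H)
    (hloc : ∀ y : (Literature.AlgebraicGeometry.Motives.projectiveSpace n k).left,
      ∃ U : (Literature.AlgebraicGeometry.Motives.projectiveSpace n k).left.affineOpens,
        y ∈ (U : (Literature.AlgebraicGeometry.Motives.projectiveSpace n k).left.Opens) ∧ (ι.ker.ideal U).IsPrincipal)
    (hfin : Set.Finite {x : H | ¬ IsRegularLocalRing (H.presheaf.stalk x)})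
    (hND : IsoHypNDWon k n H ι) : ELNatConclusionO k n H ι :=
  target_elnat_of_subchainResolution' p hp k n H ι hι hH hloc (ReachToric n) (hsub_strataLift k n)
    (hres_toricRounds n p hp k H ι hι hH hloc hfin hND)

end ND

/-- [REGISTERED 4th CHILD stub · EL♮(3) · ISOLATED · NEWTON-NONDEGENERATE RUNG — **PROVED** (THIRTY-SECOND registration's stub, desk R26 / R31 (β) DEAL «ND-K5»;
closed by res-L1-w45b-lead-2 g7 over the eleven bricks named in the module docstring)] **`stub_elnat_three_isolated_newtonNondegenerate`**: if every singular point of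
the integral hypersurface `H ⊂ ℙⁿ_k` (finitely many) has a CONVENIENT, LOCALLY Newton-nondegenerate local equation in polynomial coordinates of an affine chart together
with a WON E1-legal play of its local fan game (`IsoHypNDWon`, `…NatResidueHypDefsND` p625534), then `ELNatConclusionO k n H ι`: `O = W(k)`-style complete DVR, the
singular points treated one after the other, point and frame lifted to an `O`-section with a relative normal-crossings frame, the won play replayed as blow-ups in the
frame strata OVER the section (regular, `O`-flat centres; special fibre inside the strict transform; end regular).  TYPE = the registered TARGET 7fcd0bcbb3baba29
VERBATIM (the `n = 3` and `¬ IsRegular H` hypotheses are not used: `ND.nd_rung_local_K5` holds for every `n`).  Proof = `ND.nd_rung_local_K5`.  [OURS · L1 W4.5b] -/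
theorem stub_elnat_three_isolated_newtonNondegenerate (p : ℕ) : p.Prime → ∀ (k : Type) [Field k] [CharP k p] [IsAlgClosed k] (n : ℕ) (H : AlgebraicGeometry.Scheme.{0}) (ι : H ⟶ (Literature.AlgebraicGeometry.Motives.projectiveSpace n k).left), AlgebraicGeometry.IsClosedImmersion ι → AlgebraicGeometry.IsIntegral H → (∀ y : (Literature.AlgebraicGeometry.Motives.projectiveSpace n k).left, ∃ U : (Literature.AlgebraicGeometry.Motives.projectiveSpace n k).left.affineOpens, y ∈ (U : (Literature.AlgebraicGeometry.Motives.projectiveSpace n k).left.Opens) ∧ (ι.ker.ideal U).IsPrincipal) → n = 3 → ¬ Literature.AlgebraicGeometry.Resolution.Scheme.IsRegular H → Set.Finite {x : H | ¬ IsRegularLocalRing (H.presheaf.stalk x)} → IsoHypNDWon k n H ι → ELNatConclusionO k n H ι := by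
  intro hp k _ _ _ n H ι hι hH hloc _ _ hfin hND
  exact ND.nd_rung_local_K5 n p hp k H ι hι hH hloc hfin hND

end Summit.ResolutionOfSingularities.ResolutionOfSingularities.Cruxes.EquisingularLiftNat.Sections
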